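import Summits.AnomalousDissipation.AnomalousDissipation.Theorems.SawtoothPulseCascadeLipAgmonApproxSol
import Summits.AnomalousDissipation.AnomalousDissipation.Theorems.SawtoothPulseCascadeK3LocalisedClosurePointGlue

/-!
# The crux K3loc = `K3LocalisedClosure` (stmt-AnomalousDissipation-19492) of the route
`AnomalousDissipation/SawtoothPulseCascade`, CLOSED (lead g4, line `lip-agmon`)

`K3LocalisedClosure := K1LocalisedCascade → K2LinearisedCascadeGrowth → Target`. Proof: the line
`lip-agmon` gives, from `K2″` alone, the Grenier approximate solution on the sub-box `ρN = 2`
(`LipAgmon.approxSol58_two_of`: Agmon on `𝕋²` for `∂ⱼL` + shear-nilpotent growth of the response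
vorticity derivatives + the closure arithmetic `256r + 16(1+γ)² + 4(1+γ+γ²)² < r³`, `r = γ² − 3`, on
`[5,8]`), and the pre-certified re-glue `k3LocalisedClosure_of_approxSol_two` (packaging
`stub_regularity`/`stub_existence`, the pointwise drift-free closure `planarAnomalousFamily_of` at the
glue point `(5,2)`, and the 2½-D lift `DriftFree.liftClassical`) turns it into `K3LocalisedClosure`.
-/

set_option linter.dupNamespace false

namespace Summit.AnomalousDissipation.AnomalousDissipation.Theorems.SawtoothPulseCascade

/-- **K3loc.** `K1LocalisedCascade → K2LinearisedCascadeGrowth → Target` for the route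
`AnomalousDissipation/SawtoothPulseCascade`: the lead's line `lip-agmon` (`LipAgmon.approxSol58_two_of`,
the approximate solution on `ρN = 2` from `K2″` alone) fed into the pre-certified point re-glue
`k3LocalisedClosure_of_approxSol_two`. [folklore] -/
theorem k3LocalisedClosure_proof :
    Summit.AnomalousDissipation.AnomalousDissipation.Theses.SawtoothPulseCascade.K3LocalisedClosure :=
  k3LocalisedClosure_of_approxSol_two LipAgmon.approxSol58_two_of

end Summit.AnomalousDissipation.AnomalousDissipation.Theorems.SawtoothPulseCascade
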